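/-
Copyright: statement-level skeleton of a published paper (lit-balaban cell, reader/typer r15). No proof claims beyond
what the kernel checks below.
-/
import Literature.MathematicalPhysics.QuantumFieldTheory.Balaban1983to89.LatticeFieldCalculus

/-!
# B3 — T. Bałaban, *(Higgs)₂,₃ quantum fields in a finite volume. III. Renormalization*, CMP **88** (1983) 411–445
[Balaban1983Higgs3], Sect. 3 pp. 435–437: the lowest-order scalar self-energy graph minus its mass counterterm, (3.9), its
Taylor rearrangement (3.11), and the lattice identities of (3.16)

statement-level skeleton of published theorems with citation tags; proofs where landed; nothing here is a claim about
the Yang–Mills mass gap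

Source: held text `paper:balaban1983-higgs-2-3-quantum-fields-finite-volume` (journal page = PDF page + 410); renders of
pp. 435–437 read as images (`run/shared/lean/pub/pub-balaban/b2b-balaban-ref1/pages/1983-cmp88-higgs23-III/…-p025,p026,
p027-x2.png`).  Rows **B3.Eq3.6-3.9** and **B3.Eq3.11-3.17** of `HOME/lit-balaban-r15/ROWS-B3.md` (reader/typer r15, fold
owner of B3).  CARRIERS: the tori, site fields and the linear lattice calculus OF RECORD (`…Balaban1983to89.Setup`: `Site P j`,
`SiteField`; `LatticeFieldCalculus`: `pdiff` = ∂^η_μ, `pdiffAdj` = ∂^{η*}_μ, `laplace` = Σ_μ∂^{η*}_μ∂^η_μ), scalar fields with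
values in a real inner-product space `W` (the paper: ℝ^N), the charge matrix `q : W →ₗ[ℝ] W` (antisymmetric where needed),
two-point kernels `Kernel P j = Site P j → Site P j → ℝ` for G_{(j)}(0), G_{(j′)}, C^ξ (internal-index structure of the free
propagators = identity, so the bracket of (3.9) is a scalar kernel times q²).

THE PRINTED TEXT (verbatim).  p. 435 [PDF 25]: *"Let us start with self-energy graphs for scalar fields. The graphs of lowest
order are [three pictures] (D = −d + 2), (3.6) and the renormalized class G_ren contains the corresponding mass renormalization
counterterms also: [(−1)·three pictures] (3.7) The two last terms in (3.7) cancel exactly the two last terms in (3.6), so the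
expressions containing these terms vanish (Wick ordering). We will consider in detail an expression corresponding to
[picture − picture] (3.8) … The expression corresponding to (3.8) is
− Σ_{x,x′} η^{2d}φ(x)·[Σ_{μ=1}^d q(∂^η_μG_{(j)}(0)∂^{η*}_μ)(x,x′)qg(x)G_{(j′)}(x,x′)g′(x′)]φ′(x′)
+ Σ_{x,x′} η^{2d}φ(x)·[Σ_{μ=1}^d q(∂^η_μG_{(j)}(0)∂^{η*}_μ)(x,x′)qg(x)G_{(j′)}(x,x′)g′(x′)]φ′(x), (3.9)
where g, g′ are localization functions. To this expression we apply Taylor's formula in the form (3.10) … We apply it to a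
leg φ′, but let us notice that the expression (3.9) is symmetric in φ, φ′, so we could equally well apply it to the leg φ."*
p. 436 [PDF 26]: *"We get (the expression (3.9)) = − Σ_{μ=1}^d Σ_x η^dφ(x)·[Σ_{x′}η^d Σ_{ν=1}^d q(∂^η_νG_{(j)}(0)∂^{η*}_ν)(x,x′)q
·g(x)G_{(j′)}(x,x′)g′(x′)(x′_μ − x_μ)](∂^η_μφ′)(x) − Σ_{x,x′}η^{2d}φ(x)·[qΣ_{μ=1}^d(∂^η_μG_{(j)}(0)∂^{η*}_μ)(x,x′)qg(x)G_{(j′)}(x,x′)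
g′(x′)|x′−x|^{1+α}]·Σ_{b⊂Γ_{x,x′}} (η|b_−−x|^α/|x′−x|^{1+α})((∂^ηφ′)(b) − (∂^ηφ′)((b)_x))/|b_−−x|^α. (3.11)"*
p. 437 [PDF 27]: *"Next we replace G^ξ_{j″}(0) by C^ξ = (−Δ^ξ + 1)^{−1}: G^ξ_{j″}(0) = C^ξ + G^ξ_{j″}(0)(1 − m²_{j″} − a_{j″}P_{j″})C^ξ.
We have Σ_{ν=1}^d ∂^ξ_νC^ξ∂^{ξ*}_ν = −Δ^ξC^ξ = δ^ξ − C^ξ and δ^ξ(y′−y)(y′_μ−y_μ) = 0, so the expression is equal to … (3.16)"*.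

WHAT IS TYPED / PROVED.  §2: the kernel (∂^η_μG∂^{η*}_μ)(x,x′) as an explicit four-term difference quotient (`dKernel`), PROVED
to be the kernel of the operator ∂^η_μ ∘ G ∘ ∂^{η*}_μ for the volume element η^d (`kernelOp_dKernel`) and symmetric when G is
(`dKernel_symm`).  §3: **(3.9)** as a def with body (`expr39` = −`graphTerm39` + `counterTerm39`, the bracket = `coeff39`·q²),
`expr39_eq_sub` (the two terms combine to φ′(x′) − φ′(x), the form Taylor's formula is applied to), and the printed symmetry:
`counterTerm39_swap`, `graphTerm39_swap`, **`expr39_symm`**.  §4: **(3.11)** PROVED (`eq311`) as the rearrangement of (3.9)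
under the Taylor identity (3.10), which enters as the hypothesis `hT` in its printed shape φ′(x′) − φ′(x) = Σ_μ(x′_μ − x_μ)
(∂^η_μφ′)(x) + R(x,x′) (row B3.Eq3.10: `B3Sect3Statements.taylor310`, V1 instances `B3Eq28SummationByParts.taylor310_run/_stair`).
§5: the three identities of **(3.16)** PROVED: the resolvent identity G = C + G(1 − m² − aP)C for linear operators with
G(−Δ + m² + aP) = I and (−Δ + 1)C = I (`eq316_resolvent`); Σ_ν∂_νC∂^*_ν = (−Δ)C for every linear C commuting with the ∂^*_ν
— translation invariance, "C^ξ(y − y′)" — (`eq316_sum_pdiff_eq_laplace`, with ∂_ν∂^*_ν = ∂^*_ν∂_ν on the torus,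
`pdiff_pdiffAdj_comm`) and hence = δ − C when (−Δ + 1)C = I (`eq316_sum_pdiff`); δ(y′−y)(y′_μ−y_μ) = 0 (`eq316_delta`).

TRANSCRIPT NOTES.  T1 («symmetric in φ, φ′»): exact when the two legs carry the same localization function, g = g′
(`expr39_symm`); for g ≠ g′ the swap φ ↔ φ′ leaves the counterterm unchanged (`counterTerm39_swap`) and exchanges g, g′ in the
graph term (`graphTerm39_swap`) — the structural symmetry the sentence uses ("we could equally well apply it to the leg φ").
T2 (signs): the paper's Δ^ξ is ≤ 0 (C^ξ = (−Δ^ξ + 1)^{−1}); the tree's `laplace` = Σ∂^*∂ = −Δ^ξ.  T3: the coordinate differences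
(x′_μ − x_μ) along the contour Γ_{x,x′} and the remainder of (3.10) are supplied data of `eq311` (`dx`, `R`); the |x′−x|^{1+α}
inserted-and-divided in the printed second term is not performed.  NOT TYPED: the pictures (3.6)–(3.8), (3.12), (3.17), the
estimates (3.13)–(3.14), and the explicit vertex coefficient after (3.16) (kernels of the composed operators).  NOTHING beyond
the kernel-checked statements below is asserted.

v1.1 (append-only, r15 gen 2; row B3.Eq3.21-3.24): **(3.23)** p. 439 `expr323` (the two-scalar-leg graph with one leg
differentiated, def with body; kernel (∂^η_μG)(x,x′) = `d1Kernel`, PROVED to be the kernel of ∂^η_μ ∘ G, `kernelOp_d1Kernel`)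
and the p. 439 splitting g′(x′) = g′(x) + (g′(x′) − g′(x)) of its bracket (`bracket323_split`, PROVED); (3.21)–(3.22) pictures
and the momentum integral (3.24) are not typed.

v1.2 (append-only, r15 gen 3; row B3.Eq3.11-3.17): **(3.15)** p. 437 (`bracket315`, `expr315` — the first term of (3.11) with
both propagators at the index j″, `expr315_eq`) and the ASSEMBLY of the final expression of **(3.16)** PROVED at kernel level
(`bracket316`, `eq316_bracket`, `expr315_eq_bracket316`: from G^ξ_{j″}(0) = C^ξ + M, the kernel form of Σ_ν∂^ξ_νC^ξ∂^{ξ*}_ν =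
δ^ξ − C^ξ and δ^ξ(y′−y)(y′_μ−y_μ) = 0; `dKernel_add`).
-/

open scoped BigOperators RealInnerProductSpace

namespace Literature.MathematicalPhysics.QuantumFieldTheory.Balaban1983to89.B3Sect3ScalarSelfEnergy

open LatticeFieldCalculus

noncomputable section

/-! ## 1. Torus bookkeeping (helpers) -/

section Helpers

variable {P : Params} {j : ℕ}

/-- `(x − e_μ) + e_μ = x` on the torus. [folklore] -/
private theorem shift_unshift (x : Site P j) (μ : Fin P.d) : (x.unshift μ).shift μ = x :=
  (shiftEquiv (P := P) (j := j) μ).apply_symm_apply x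

/-- `(x + e_μ) − e_μ = x` on the torus. [folklore] -/
private theorem unshift_shift (x : Site P j) (μ : Fin P.d) : (x.shift μ).unshift μ = x :=
  (shiftEquiv (P := P) (j := j) μ).symm_apply_apply x

/-- Reindexing a site sum by the translation `x ↦ x + e_μ`: `Σ_x F(x + e_μ) = Σ_x F(x)`. [folklore] -/
private theorem sum_comp_shift {α : Type*} [AddCommMonoid α] (μ : Fin P.d) (F : Site P j → α) :
    ∑ x : Site P j, F (x.shift μ) = ∑ x : Site P j, F x :=
  Equiv.sum_comp (shiftEquiv (P := P) (j := j) μ) F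

end Helpers

/-! ## 2. Two-point kernels on T^{(j)}_η and the kernel of ∂^η_μ G ∂^{η*}_μ -/

section Kernels

variable {P : Params} {j : ℕ}

/-- A two-point kernel on the torus (the free propagators G_{(j)}(0), G_{(j′)} of (3.9) and C^ξ of (3.16), p. 435–437; the
internal-index structure of these propagators is the identity and is not carried). [cite: Balaban1983Higgs3, (3.9) p.435] -/
abbrev Kernel (P : Params) (j : ℕ) : Type := Site P j → Site P j → ℝ

/-- The integral operator of a kernel with the volume element `w` (= η^d): (Kf)(x) = Σ_{x′} w K(x,x′) f(x′) — the reading of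
the kernel notation "(∂^η_μG_{(j)}(0)∂^{η*}_μ)(x,x′)" of (3.9). [cite: Balaban1983Higgs3, (3.9) p.435] -/
def kernelOp (w : ℝ) (K : Kernel P j) (f : SiteField P j ℝ) : SiteField P j ℝ :=
  fun x => ∑ x' : Site P j, w * K x x' * f x'

/-- The kernel (∂^η_μG∂^{η*}_μ)(x,x′) of (3.9), explicitly: c²[G(x+e_μ,x′+e_μ) − G(x+e_μ,x′) − G(x,x′+e_μ) + G(x,x′)], c = η^{−1}
(forward difference quotient in x, and — from ∂^{η*}_μ acting on the right — in x′). [cite: Balaban1983Higgs3, (3.9) p.435] -/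
def dKernel (c : ℝ) (μ : Fin P.d) (G : Kernel P j) : Kernel P j :=
  fun x x' => c ^ 2 * (G (x.shift μ) (x'.shift μ) - G (x.shift μ) x' - G x (x'.shift μ) + G x x')

/-- the kernel of G ∘ ∂^{η*}_μ: (G∂^{η*}_μf)(y) = Σ_{x′} w·c(G(y,x′+e_μ) − G(y,x′))·f(x′) (summation by parts on the torus). [folklore] -/
private theorem kernelOp_pdiffAdj (w c : ℝ) (μ : Fin P.d) (G : Kernel P j) (f : SiteField P j ℝ) (y : Site P j) :
    kernelOp w G (pdiffAdj c μ f) y = ∑ x' : Site P j, w * (c * (G y (x'.shift μ) - G y x')) * f x' := by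
  simp only [kernelOp, pdiffAdj, smul_eq_mul]
  have hre : ∑ x' : Site P j, w * G y x' * (c * f (x'.unshift μ)) =
      ∑ x' : Site P j, w * G y (x'.shift μ) * (c * f x') := by
    rw [← sum_comp_shift μ (fun x' => w * G y x' * (c * f (x'.unshift μ)))]
    simp only [unshift_shift]
  calc ∑ x' : Site P j, w * G y x' * (c * (f (x'.unshift μ) - f x'))
      = ∑ x' : Site P j, w * G y x' * (c * f (x'.unshift μ)) - ∑ x' : Site P j, w * G y x' * (c * f x') := by
        rw [← Finset.sum_sub_distrib]
        exact Finset.sum_congr rfl fun _ _ => by ring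
    _ = ∑ x' : Site P j, w * G y (x'.shift μ) * (c * f x') - ∑ x' : Site P j, w * G y x' * (c * f x') := by rw [hre]
    _ = ∑ x' : Site P j, w * (c * (G y (x'.shift μ) - G y x')) * f x' := by
        rw [← Finset.sum_sub_distrib]
        exact Finset.sum_congr rfl fun _ _ => by ring

/-- kernel: `dKernel` IS the kernel of the operator ∂^η_μ ∘ G ∘ ∂^{η*}_μ (volume element `w`, difference quotient `c`):
Σ_{x′} w(∂^η_μG∂^{η*}_μ)(x,x′)f(x′) = (∂^η_μ(G(∂^{η*}_μf)))(x). [cite: Balaban1983Higgs3, (3.9) p.435] -/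
theorem kernelOp_dKernel (w c : ℝ) (μ : Fin P.d) (G : Kernel P j) (f : SiteField P j ℝ) :
    kernelOp w (dKernel c μ G) f = pdiff c μ (kernelOp w G (pdiffAdj c μ f)) := by
  funext x
  rw [pdiff, kernelOp_pdiffAdj, kernelOp_pdiffAdj, smul_eq_mul, ← Finset.sum_sub_distrib, Finset.mul_sum]
  refine Finset.sum_congr rfl fun x' _ => ?_
  simp only [dKernel]
  ring

/-- kernel: (∂^η_μG∂^{η*}_μ)(x,x′) is symmetric in (x,x′) when G is. [cite: Balaban1983Higgs3, (3.9) p.435] -/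
theorem dKernel_symm (c : ℝ) (μ : Fin P.d) (G : Kernel P j) (hG : ∀ x x' : Site P j, G x x' = G x' x)
    (x x' : Site P j) : dKernel c μ G x x' = dKernel c μ G x' x := by
  rw [dKernel, dKernel, hG (x.shift μ) (x'.shift μ), hG (x.shift μ) x', hG x (x'.shift μ), hG x x']
  ring

end Kernels

/-! ## 3. (3.9): the lowest-order scalar self-energy graph minus its mass counterterm -/

section Expr39

variable {P : Params} {j : ℕ} {W : Type*} [NormedAddCommGroup W] [InnerProductSpace ℝ W]

/-- The scalar part of the square bracket of **(3.9)** p. 435: c(x,x′) = Σ_{μ=1}^d(∂^η_μG_{(j)}(0)∂^{η*}_μ)(x,x′)·g(x)G_{(j′)}(x,x′)g′(x′)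
(the bracket itself is q·c(x,x′)·q; `Gj` = G_{(j)}(0), `Gj'` = G_{(j′)}, `g`, `g'` the localization functions, η the lattice
spacing). [cite: Balaban1983Higgs3, (3.9) p.435] -/
def coeff39 (η : ℝ) (Gj Gj' : Kernel P j) (g g' : SiteField P j ℝ) : Kernel P j :=
  fun x x' => (∑ μ : Fin P.d, dKernel η⁻¹ μ Gj x x') * g x * Gj' x x' * g' x'

/-- The first (graph) term of **(3.9)** without its sign: Σ_{x,x′}η^{2d}φ(x)·[q c(x,x′) q]φ′(x′). [cite: Balaban1983Higgs3, (3.9) p.435] -/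
def graphTerm39 (η : ℝ) (q : W →ₗ[ℝ] W) (Gj Gj' : Kernel P j) (g g' : SiteField P j ℝ) (φ φ' : SiteField P j W) : ℝ :=
  ∑ x : Site P j, ∑ x' : Site P j, η ^ (2 * P.d) * (coeff39 η Gj Gj' g g' x x' * ⟪φ x, q (q (φ' x'))⟫)

/-- The second (mass-counterterm) term of **(3.9)**: Σ_{x,x′}η^{2d}φ(x)·[q c(x,x′) q]φ′(x) — both legs at x.
[cite: Balaban1983Higgs3, (3.9) p.435] -/
def counterTerm39 (η : ℝ) (q : W →ₗ[ℝ] W) (Gj Gj' : Kernel P j) (g g' : SiteField P j ℝ) (φ φ' : SiteField P j W) : ℝ :=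
  ∑ x : Site P j, ∑ x' : Site P j, η ^ (2 * P.d) * (coeff39 η Gj Gj' g g' x x' * ⟪φ x, q (q (φ' x))⟫)

/-- **(3.9)** p. 435 [PDF 25], verbatim: *"The expression corresponding to (3.8) is
− Σ_{x,x′} η^{2d}φ(x)·[Σ_{μ=1}^d q(∂^η_μG_{(j)}(0)∂^{η*}_μ)(x,x′)qg(x)G_{(j′)}(x,x′)g′(x′)]φ′(x′)
+ Σ_{x,x′} η^{2d}φ(x)·[Σ_{μ=1}^d q(∂^η_μG_{(j)}(0)∂^{η*}_μ)(x,x′)qg(x)G_{(j′)}(x,x′)g′(x′)]φ′(x), (3.9) where g, g′ are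
localization functions."* [cite: Balaban1983Higgs3, (3.9) p.435] -/
def expr39 (η : ℝ) (q : W →ₗ[ℝ] W) (Gj Gj' : Kernel P j) (g g' : SiteField P j ℝ) (φ φ' : SiteField P j W) : ℝ :=
  -graphTerm39 η q Gj Gj' g g' φ φ' + counterTerm39 η q Gj Gj' g g' φ φ'

/-- kernel: the two terms of (3.9) combine to −Σ_{x,x′}η^{2d}c(x,x′)φ(x)·q²(φ′(x′) − φ′(x)) — the form to which Taylor's formula
(3.10) is applied ("We apply it to a leg φ′"). [cite: Balaban1983Higgs3, (3.9) p.435] -/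
theorem expr39_eq_sub (η : ℝ) (q : W →ₗ[ℝ] W) (Gj Gj' : Kernel P j) (g g' : SiteField P j ℝ) (φ φ' : SiteField P j W) :
    expr39 η q Gj Gj' g g' φ φ' =
      -∑ x : Site P j, ∑ x' : Site P j, η ^ (2 * P.d) * (coeff39 η Gj Gj' g g' x x' * ⟪φ x, q (q (φ' x' - φ' x))⟫) := by
  simp only [expr39, graphTerm39, counterTerm39, map_sub, inner_sub_right, mul_sub, Finset.sum_sub_distrib]
  ring

/-- for an antisymmetric `q`, φ·q²φ′ = φ′·q²φ. [folklore] -/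
private theorem inner_qq_comm (q : W →ₗ[ℝ] W) (hq : ∀ u v : W, ⟪q u, v⟫ = -⟪u, q v⟫) (a b : W) :
    ⟪a, q (q b)⟫ = ⟪b, q (q a)⟫ := by
  have h1 := hq a (q b)
  have h2 := hq b (q a)
  rw [real_inner_comm (q a) (q b)] at h2
  linarith

/-- kernel (T1): the counterterm of (3.9) is unchanged under the swap φ ↔ φ′ (q antisymmetric ⇒ q² symmetric).
[cite: Balaban1983Higgs3, (3.9) p.435] -/
theorem counterTerm39_swap (η : ℝ) (q : W →ₗ[ℝ] W) (hq : ∀ u v : W, ⟪q u, v⟫ = -⟪u, q v⟫) (Gj Gj' : Kernel P j)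
    (g g' : SiteField P j ℝ) (φ φ' : SiteField P j W) :
    counterTerm39 η q Gj Gj' g g' φ' φ = counterTerm39 η q Gj Gj' g g' φ φ' := by
  unfold counterTerm39
  refine Finset.sum_congr rfl fun x _ => Finset.sum_congr rfl fun x' _ => ?_
  rw [inner_qq_comm q hq (φ' x) (φ x)]

/-- kernel (T1): under the swap φ ↔ φ′ the graph term of (3.9) becomes the graph term with the localization functions
exchanged, g ↔ g′ (G_{(j)}(0), G_{(j′)} symmetric, q antisymmetric). [cite: Balaban1983Higgs3, (3.9) p.435] -/
theorem graphTerm39_swap (η : ℝ) (q : W →ₗ[ℝ] W) (hq : ∀ u v : W, ⟪q u, v⟫ = -⟪u, q v⟫) (Gj Gj' : Kernel P j)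
    (hGj : ∀ x x' : Site P j, Gj x x' = Gj x' x) (hGj' : ∀ x x' : Site P j, Gj' x x' = Gj' x' x)
    (g g' : SiteField P j ℝ) (φ φ' : SiteField P j W) :
    graphTerm39 η q Gj Gj' g g' φ' φ = graphTerm39 η q Gj Gj' g' g φ φ' := by
  unfold graphTerm39
  conv_lhs => rw [Finset.sum_comm]
  refine Finset.sum_congr rfl fun a _ => Finset.sum_congr rfl fun b _ => ?_
  have hK : ∑ μ : Fin P.d, dKernel η⁻¹ μ Gj b a = ∑ μ : Fin P.d, dKernel η⁻¹ μ Gj a b :=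
    Finset.sum_congr rfl fun μ _ => dKernel_symm _ μ Gj hGj b a
  rw [coeff39, coeff39, hK, hGj' b a, inner_qq_comm q hq (φ' b) (φ a)]
  ring

/-- **(3.9)**, the printed symmetry, p. 435: *"let us notice that the expression (3.9) is symmetric in φ, φ′, so we could equally
well apply it to the leg φ"* — PROVED for legs carrying the same localization function g = g′ (T1: for g ≠ g′ see
`graphTerm39_swap`, `counterTerm39_swap`), G_{(j)}(0), G_{(j′)} symmetric, q antisymmetric. [cite: Balaban1983Higgs3, (3.9) p.435] -/
theorem expr39_symm (η : ℝ) (q : W →ₗ[ℝ] W) (hq : ∀ u v : W, ⟪q u, v⟫ = -⟪u, q v⟫) (Gj Gj' : Kernel P j)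
    (hGj : ∀ x x' : Site P j, Gj x x' = Gj x' x) (hGj' : ∀ x x' : Site P j, Gj' x x' = Gj' x' x)
    (g : SiteField P j ℝ) (φ φ' : SiteField P j W) :
    expr39 η q Gj Gj' g g φ' φ = expr39 η q Gj Gj' g g φ φ' := by
  rw [expr39, expr39, graphTerm39_swap η q hq Gj Gj' hGj hGj' g g φ φ', counterTerm39_swap η q hq Gj Gj' g g φ φ']

end Expr39

/-! ## 4. (3.11): (3.9) after Taylor's formula (3.10) applied to the leg φ′ -/

section Eq311

variable {P : Params} {j : ℕ} {W : Type*} [NormedAddCommGroup W] [InnerProductSpace ℝ W]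

/-- **(3.11)** p. 436 [PDF 26], verbatim: *"We get (the expression (3.9)) = − Σ_{μ=1}^d Σ_x η^dφ(x)·[Σ_{x′}η^dΣ_{ν=1}^d
q(∂^η_νG_{(j)}(0)∂^{η*}_ν)(x,x′)q·g(x)G_{(j′)}(x,x′)g′(x′)(x′_μ − x_μ)](∂^η_μφ′)(x) − Σ_{x,x′}η^{2d}φ(x)·[qΣ_{μ=1}^d(∂^η_μG_{(j)}(0)
∂^{η*}_μ)(x,x′)qg(x)G_{(j′)}(x,x′)g′(x′)|x′−x|^{1+α}]·Σ_{b⊂Γ_{x,x′}}(η|b_−−x|^α/|x′−x|^{1+α})((∂^ηφ′)(b) − (∂^ηφ′)((b)_x))/|b_−−x|^α.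
(3.11)"* — PROVED as the rearrangement of (3.9) under Taylor's formula (3.10) for the leg φ′, which enters as `hT` in its
printed shape φ′(x′) − φ′(x) = Σ_μ(x′_μ − x_μ)(∂^η_μφ′)(x) + R(x,x′) (`dx μ x x′` = x′_μ − x_μ along Γ_{x,x′}, `D μ` = ∂^η_μφ′,
`R` = the remainder sum over the bonds of Γ_{x,x′}; T3: the factor |x′−x|^{1+α} inserted and divided in print is not
performed). [cite: Balaban1983Higgs3, (3.11) p.436] -/
theorem eq311 (η : ℝ) (q : W →ₗ[ℝ] W) (Gj Gj' : Kernel P j) (g g' : SiteField P j ℝ) (φ φ' : SiteField P j W)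
    (dx : Fin P.d → Site P j → Site P j → ℝ) (D : Fin P.d → SiteField P j W) (R : Site P j → Site P j → W)
    (hT : ∀ x x' : Site P j, φ' x' - φ' x = (∑ μ : Fin P.d, dx μ x x' • D μ x) + R x x') :
    expr39 η q Gj Gj' g g' φ φ' =
      -(∑ μ : Fin P.d, ∑ x : Site P j, η ^ P.d *
          ((∑ x' : Site P j, η ^ P.d * (coeff39 η Gj Gj' g g' x x' * dx μ x x')) * ⟪φ x, q (q (D μ x))⟫)) -
        ∑ x : Site P j, ∑ x' : Site P j, η ^ (2 * P.d) * (coeff39 η Gj Gj' g g' x x' * ⟪φ x, q (q (R x x'))⟫) := by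
  rw [expr39_eq_sub, ← neg_add']
  congr 1
  have h2d : η ^ (2 * P.d) = η ^ P.d * η ^ P.d := by rw [two_mul, pow_add]
  -- the Taylor identity inside the pairing, by bilinearity
  have hterm : ∀ x x' : Site P j, ⟪φ x, q (q (φ' x' - φ' x))⟫ =
      (∑ μ : Fin P.d, dx μ x x' * ⟪φ x, q (q (D μ x))⟫) + ⟪φ x, q (q (R x x'))⟫ := by
    intro x x'
    rw [hT x x', map_add, map_add, inner_add_right, map_sum, map_sum, inner_sum]
    congr 1
    refine Finset.sum_congr rfl fun μ _ => ?_
    rw [map_smul, map_smul, real_inner_smul_right]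
  -- split every (x,x′) term into its μ-part and its remainder part
  have hsplit : ∀ x x' : Site P j,
      η ^ (2 * P.d) * (coeff39 η Gj Gj' g g' x x' * ⟪φ x, q (q (φ' x' - φ' x))⟫) =
        (∑ μ : Fin P.d, η ^ P.d * (η ^ P.d * (coeff39 η Gj Gj' g g' x x' * dx μ x x') * ⟪φ x, q (q (D μ x))⟫)) +
          η ^ (2 * P.d) * (coeff39 η Gj Gj' g g' x x' * ⟪φ x, q (q (R x x'))⟫) := by
    intro x x'
    rw [hterm, mul_add, mul_add, Finset.mul_sum, Finset.mul_sum, h2d]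
    congr 1
    exact Finset.sum_congr rfl fun μ _ => by ring
  simp_rw [hsplit, Finset.sum_add_distrib]
  congr 1
  -- reorder Σ_x Σ_x′ Σ_μ into Σ_μ Σ_x (Σ_x′ …)·(…)
  calc ∑ x : Site P j, ∑ x' : Site P j, ∑ μ : Fin P.d,
          η ^ P.d * (η ^ P.d * (coeff39 η Gj Gj' g g' x x' * dx μ x x') * ⟪φ x, q (q (D μ x))⟫)
      = ∑ x : Site P j, ∑ μ : Fin P.d, ∑ x' : Site P j,
          η ^ P.d * (η ^ P.d * (coeff39 η Gj Gj' g g' x x' * dx μ x x') * ⟪φ x, q (q (D μ x))⟫) :=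
        Finset.sum_congr rfl fun x _ => Finset.sum_comm
    _ = ∑ μ : Fin P.d, ∑ x : Site P j, ∑ x' : Site P j,
          η ^ P.d * (η ^ P.d * (coeff39 η Gj Gj' g g' x x' * dx μ x x') * ⟪φ x, q (q (D μ x))⟫) := Finset.sum_comm
    _ = ∑ μ : Fin P.d, ∑ x : Site P j, η ^ P.d *
          ((∑ x' : Site P j, η ^ P.d * (coeff39 η Gj Gj' g g' x x' * dx μ x x')) * ⟪φ x, q (q (D μ x))⟫) := by
        refine Finset.sum_congr rfl fun μ _ => Finset.sum_congr rfl fun x _ => ?_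
        rw [Finset.sum_mul, Finset.mul_sum]

end Eq311

/-! ## 5. (3.16): the resolvent identity, Σ_ν ∂_νC∂^*_ν = −ΔC = δ − C, and δ(y′−y)(y′_μ−y_μ) = 0 -/

section Eq316

variable {M : Type*} [AddCommGroup M] [Module ℝ M]

/-- **(3.16)** p. 437 [PDF 27], first identity, verbatim: *"Next we replace G^ξ_{j″}(0) by C^ξ = (−Δ^ξ + 1)^{−1}:
G^ξ_{j″}(0) = C^ξ + G^ξ_{j″}(0)(1 − m²_{j″} − a_{j″}P_{j″})C^ξ."* — PROVED as the second resolvent identity for linear operators: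
`G` a left inverse of −Δ + m² + aP (`hG`; G^ξ_{j″}(0) = (−Δ^ξ + m²_{j″} + a_{j″}P_{j″})^{−1}, `Lap` = −Δ^ξ, `Pop` = P_{j″}) and
`C` a right inverse of −Δ + 1 (`hC`). [cite: Balaban1983Higgs3, (3.16) p.437] -/
theorem eq316_resolvent (Lap Pop G C : M →ₗ[ℝ] M) (msq a : ℝ) (hG : ∀ v : M, G (Lap v + msq • v + a • Pop v) = v)
    (hC : ∀ v : M, Lap (C v) + C v = v) (v : M) :
    G v = C v + G ((1 - msq) • C v - a • Pop (C v)) := by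
  have key : (1 - msq) • C v - a • Pop (C v) = (Lap (C v) + C v) - (Lap (C v) + msq • C v + a • Pop (C v)) := by
    module
  rw [key, map_sub, hC, hG]
  abel

variable {P : Params} {j : ℕ}

/-- kernel: on the torus the forward and backward difference quotients in one direction commute, ∂_ν∂^*_ν = ∂^*_ν∂_ν (both equal
c²(2f(x) − f(x+e_ν) − f(x−e_ν)) up to sign). [folklore] -/
private theorem pdiff_pdiffAdj_comm (c : ℝ) (ν : Fin P.d) (f : SiteField P j ℝ) :
    pdiff c ν (pdiffAdj c ν f) = pdiffAdj c ν (pdiff c ν f) := by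
  funext x
  simp only [pdiff, pdiffAdj, smul_eq_mul, unshift_shift, shift_unshift]
  ring

/-- **(3.16)** p. 437, second identity, first equality: *"We have Σ_{ν=1}^d ∂^ξ_νC^ξ∂^{ξ*}_ν = −Δ^ξC^ξ"* — PROVED for every linear
`C` commuting with the backward difference quotients ∂^{ξ*}_ν (translation invariance: C^ξ = C^ξ(y − y′)); T2: the tree's
`laplace` = Σ_ν∂^*_ν∂_ν is the paper's −Δ^ξ. [cite: Balaban1983Higgs3, (3.16) p.437] -/
theorem eq316_sum_pdiff_eq_laplace (c : ℝ) (C : SiteField P j ℝ →ₗ[ℝ] SiteField P j ℝ)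
    (hCa : ∀ (ν : Fin P.d) (f : SiteField P j ℝ), C (pdiffAdj c ν f) = pdiffAdj c ν (C f)) (f : SiteField P j ℝ) :
    ∑ ν : Fin P.d, pdiff c ν (C (pdiffAdj c ν f)) = laplace c (C f) := by
  funext x
  rw [Finset.sum_apply, laplace_apply]
  refine Finset.sum_congr rfl fun ν _ => ?_
  rw [hCa, pdiff_pdiffAdj_comm]

/-- **(3.16)** p. 437, second identity in full: *"Σ_{ν=1}^d ∂^ξ_νC^ξ∂^{ξ*}_ν = −Δ^ξC^ξ = δ^ξ − C^ξ"* — PROVED for a translation-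
invariant (`hCa`) linear `C` with (−Δ^ξ + 1)C^ξ = I (`hC`, i.e. C^ξ = (−Δ^ξ + 1)^{−1}): applied to any f, Σ_ν∂_ν(C(∂^*_νf)) =
f − Cf. [cite: Balaban1983Higgs3, (3.16) p.437] -/
theorem eq316_sum_pdiff (c : ℝ) (C : SiteField P j ℝ →ₗ[ℝ] SiteField P j ℝ)
    (hCa : ∀ (ν : Fin P.d) (f : SiteField P j ℝ), C (pdiffAdj c ν f) = pdiffAdj c ν (C f))
    (hC : ∀ f : SiteField P j ℝ, laplace c (C f) + C f = f) (f : SiteField P j ℝ) :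
    ∑ ν : Fin P.d, pdiff c ν (C (pdiffAdj c ν f)) = f - C f := by
  rw [eq316_sum_pdiff_eq_laplace c C hCa f]
  exact eq_sub_of_add_eq (hC f)

/-- **(3.16)** p. 437, third identity: *"and δ^ξ(y′−y)(y′_μ−y_μ) = 0"* — the δ-kernel kills the coordinate difference (which
vanishes at y′ = y, `h0`). [cite: Balaban1983Higgs3, (3.16) p.437] -/
theorem eq316_delta (dxμ : Site P j → Site P j → ℝ) (h0 : ∀ y : Site P j, dxμ y y = 0) (y y' : Site P j) :
    (if y' = y then (1 : ℝ) else 0) * dxμ y y' = 0 := by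
  split_ifs with h
  · rw [h, h0, mul_zero]
  · rw [zero_mul]

end Eq316

/-! ## v1.1 (append-only): (3.23) p. 439 — the two-scalar-leg graph with one leg differentiated -/

section Eq323

variable {P : Params} {j : ℕ}

/-- The kernel (∂^η_μG)(x,x′) of (3.23): c(G(x+e_μ,x′) − G(x,x′)), c = η^{−1} (forward difference quotient in the first
variable). [cite: Balaban1983Higgs3, (3.23) p.439] -/
def d1Kernel (c : ℝ) (μ : Fin P.d) (G : Kernel P j) : Kernel P j :=
  fun x x' => c * (G (x.shift μ) x' - G x x')

/-- kernel: `d1Kernel` IS the kernel of ∂^η_μ ∘ G: Σ_{x′} w(∂^η_μG)(x,x′)f(x′) = (∂^η_μ(Gf))(x). [cite: Balaban1983Higgs3, (3.23) p.439] -/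
theorem kernelOp_d1Kernel (w c : ℝ) (μ : Fin P.d) (G : Kernel P j) (f : SiteField P j ℝ) :
    kernelOp w (d1Kernel c μ G) f = pdiff c μ (kernelOp w G f) := by
  funext x
  simp only [kernelOp, d1Kernel, pdiff, smul_eq_mul, Finset.mul_sum, ← Finset.sum_sub_distrib]
  exact Finset.sum_congr rfl fun x' _ => by ring

variable {W : Type*} [NormedAddCommGroup W] [InnerProductSpace ℝ W]

/-- The square bracket of **(3.23)** p. 439 without q²: Σ_{x′}η^d(∂^η_μG^η_{j″}(0))(x,x′)g(x)G^η_{j″}(x,x′)g′(x′) (`G0` = G^η_{j″}(0),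
`Gj` = G^η_{j″}). [cite: Balaban1983Higgs3, (3.23) p.439] -/
def bracket323 (η : ℝ) (μ : Fin P.d) (G0 Gj : Kernel P j) (g g' : SiteField P j ℝ) (x : Site P j) : ℝ :=
  ∑ x' : Site P j, η ^ P.d * (d1Kernel η⁻¹ μ G0 x x' * g x * Gj x x' * g' x')

/-- **(3.23)** p. 439 [PDF 29], verbatim: *"we sum over proper orderings and j-indices and we get
Σ_{μ=1}^d Σ_x η^dφ(x)·[q²Σ_{x′}η^d(∂^η_μG^η_{j″}(0))(x,x′)g(x)G^η_{j″}(x,x′)g′(x′)](∂^η_μφ′)(x). (3.23)"* — the derivative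
of the leg, ∂^η_μφ′, is the concrete `pdiff η⁻¹ μ φ′`; q² acts on it. [cite: Balaban1983Higgs3, (3.23) p.439] -/
def expr323 (η : ℝ) (q : W →ₗ[ℝ] W) (G0 Gj : Kernel P j) (g g' : SiteField P j ℝ) (φ φ' : SiteField P j W) : ℝ :=
  ∑ μ : Fin P.d, ∑ x : Site P j, η ^ P.d * (bracket323 η μ G0 Gj g g' x * ⟪φ x, q (q (pdiff η⁻¹ μ φ' x))⟫)

/-- p. 439, after (3.23), verbatim: *"Further if we take g′(x′) = g′(x) + ((g′(x′) − g′(x))/|x′−x|)|x′−x|, then the expression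
in the square bracket in (3.23) containing the second term will be convergent and the expression with the first term is equal
to q²g(x)g′(x)Σ_{x′}η^d(∂^η_μG^η_{j″}(0))(x,x′)G^η_{j″}(x,x′)."* — PROVED as the splitting of the bracket (the |x′−x|
inserted and divided is not performed; the convergence claims are not typed). [cite: Balaban1983Higgs3, (3.23) p.439] -/
theorem bracket323_split (η : ℝ) (μ : Fin P.d) (G0 Gj : Kernel P j) (g g' : SiteField P j ℝ) (x : Site P j) :
    bracket323 η μ G0 Gj g g' x =
      g x * g' x * (∑ x' : Site P j, η ^ P.d * (d1Kernel η⁻¹ μ G0 x x' * Gj x x')) +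
        ∑ x' : Site P j, η ^ P.d * (d1Kernel η⁻¹ μ G0 x x' * g x * Gj x x' * (g' x' - g' x)) := by
  rw [bracket323, Finset.mul_sum, ← Finset.sum_add_distrib]
  exact Finset.sum_congr rfl fun x' _ => by ring

end Eq323

/-! ## v1.2 (append-only): (3.15) and the assembly of the bracket of (3.16), p. 437 -/

section Eq315

variable {P : Params} {j : ℕ} {W : Type*} [NormedAddCommGroup W] [InnerProductSpace ℝ W]

/-- The square bracket of **(3.15)** p. 437 [PDF 27] without the charge matrices: Σ_{x′}η^dΣ_ν(∂^η_νG^η_{j″}(0)∂^{η*}_ν)(x,x′)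
g(x)G^η_{j″}(x,x′)g′(x′)(x′_μ − x_μ) — the bracket of the first term of (3.11) after the summation over orderings and indices
(both propagators at the index j″: `G0` = G^η_{j″}(0), `G` = G^η_{j″}; `dx μ x x′` = x′_μ − x_μ; the matrices q…q act on the
legs as in `eq311`). [cite: Balaban1983Higgs3, (3.15) p.437] -/
def bracket315 (η : ℝ) (G0 G : Kernel P j) (g g' : SiteField P j ℝ) (dx : Fin P.d → Site P j → Site P j → ℝ)
    (μ : Fin P.d) (x : Site P j) : ℝ :=
  ∑ x' : Site P j, η ^ P.d * (coeff39 η G0 G g g' x x' * dx μ x x')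

/-- **(3.15)** p. 437 [PDF 27], verbatim: *"Making summations over these orderings and indices means that we sum with respect
to j, j′ from 0 to j″, where j″ is the lowest index of the external lines. After the summations we get − Σ_{μ=1}^d Σ_x η^dφ(x)·
[Σ_{x′}η^d Σ_{ν=1}^d q(∂^η_νG^η_{j″}(0)∂^{η*}_ν)(x,x′)qg(x)G^η_{j″}(x,x′)g′(x′)(x′_μ − x_μ)](∂^η_μφ′)(x), (3.15)"* (`D μ` = ∂^η_μφ′;
the summation over orderings/indices itself — a statement about the expansion — is not typed). [cite: Balaban1983Higgs3, (3.15) p.437] -/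
def expr315 (η : ℝ) (q : W →ₗ[ℝ] W) (G0 G : Kernel P j) (g g' : SiteField P j ℝ)
    (dx : Fin P.d → Site P j → Site P j → ℝ) (φ : SiteField P j W) (D : Fin P.d → SiteField P j W) : ℝ :=
  -∑ μ : Fin P.d, ∑ x : Site P j, η ^ P.d * (bracket315 η G0 G g g' dx μ x * ⟪φ x, q (q (D μ x))⟫)

/-- kernel: (3.15) is the first term of the right side of (3.11) (`eq311`) with both propagators at the index j″.
[cite: Balaban1983Higgs3, (3.15) p.437] -/
theorem expr315_eq (η : ℝ) (q : W →ₗ[ℝ] W) (G0 G : Kernel P j) (g g' : SiteField P j ℝ)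
    (dx : Fin P.d → Site P j → Site P j → ℝ) (φ : SiteField P j W) (D : Fin P.d → SiteField P j W) :
    expr315 η q G0 G g g' dx φ D =
      -(∑ μ : Fin P.d, ∑ x : Site P j, η ^ P.d *
          ((∑ x' : Site P j, η ^ P.d * (coeff39 η G0 G g g' x x' * dx μ x x')) * ⟪φ x, q (q (D μ x))⟫)) := rfl

/-- kernel: the kernel (∂_νK∂^*_ν)(x,x′) is additive in K. [cite: Balaban1983Higgs3, (3.16) p.437] -/
theorem dKernel_add (c : ℝ) (ν : Fin P.d) (K M : Kernel P j) (x x' : Site P j) :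
    dKernel c ν (fun y y' => K y y' + M y y') x x' = dKernel c ν K x x' + dKernel c ν M x x' := by
  simp only [dKernel]
  ring

/-- The final expression of **(3.16)** p. 437 [PDF 27] without the charge matrices q²: Σ_{y′}ξ^d[−C^ξ(y−y′) +
Σ_ν(∂^ξ_νG^ξ_{j″}(0)(1 − m²_{j″} − a_{j″}P_{j″})C^ξ∂^{ξ*}_ν)(y,y′)]g(y)G^ξ_{j″}(y,y′)g′(y′)(y′_μ − y_μ), verbatim: *"so the expression is
equal to −q²Σ_{y′}ξ^dC^ξ(y−y′)g(y)G^ξ_{j″}(y,y′)g(y′)(y′_μ−y_μ) + q²Σ_{y′}ξ^d(Σ_{ν=1}^d(∂^ξ_νG^ξ_{j″}(0)(1−m²_{j″}−a_{j″}P_{j″})C^ξ∂^{ξ*}_ν)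
(y,y′))·g(y)G^ξ_{j″}(y,y′)g′(y′)(y′_μ−y_μ). (3.16)"* (`C` = C^ξ as a kernel, `M` = the kernel of G^ξ_{j″}(0)(1−m²_{j″}−a_{j″}P_{j″})C^ξ,
`G` = G^ξ_{j″}; print has g(y′) once for g′(y′)). [cite: Balaban1983Higgs3, (3.16) p.437] -/
def bracket316 (ξ : ℝ) (C M G : Kernel P j) (g g' : SiteField P j ℝ) (dx : Fin P.d → Site P j → Site P j → ℝ)
    (μ : Fin P.d) (y : Site P j) : ℝ :=
  ∑ y' : Site P j, ξ ^ P.d *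
    ((-C y y' + ∑ ν : Fin P.d, dKernel ξ⁻¹ ν M y y') * g y * G y y' * g' y' * dx μ y y')

/-- **(3.16)** p. 437 [PDF 27], the ASSEMBLY of its final expression — PROVED at the level of kernels: if the resummed propagator
splits as G^ξ_{j″}(0) = C^ξ + M (`hG0`; the resolvent identity `eq316_resolvent`, M = G^ξ_{j″}(0)(1−m²_{j″}−a_{j″}P_{j″})C^ξ), the free
propagator satisfies Σ_ν(∂^ξ_νC^ξ∂^{ξ*}_ν)(y,y′) = δ^ξ(y,y′) − C^ξ(y,y′) as kernels for the volume element ξ^d (`hC`: δ^ξ(y,y′) =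
ξ^{−d}[y′ = y]; the operator form is `eq316_sum_pdiff`) and the coordinate difference vanishes on the diagonal (`hdx`, cf.
`eq316_delta`), then the bracket of (3.15) on the ξ-lattice equals the bracket of (3.16). [cite: Balaban1983Higgs3, (3.16) p.437] -/
theorem eq316_bracket (ξ : ℝ) (G0 C M G : Kernel P j) (g g' : SiteField P j ℝ)
    (dx : Fin P.d → Site P j → Site P j → ℝ) (μ : Fin P.d)
    (hG0 : G0 = fun y y' => C y y' + M y y')
    (hC : ∀ y y' : Site P j, ∑ ν : Fin P.d, dKernel ξ⁻¹ ν C y y' = (if y' = y then (ξ ^ P.d)⁻¹ else 0) - C y y')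
    (hdx : ∀ y : Site P j, dx μ y y = 0) (y : Site P j) :
    bracket315 ξ G0 G g g' dx μ y = bracket316 ξ C M G g g' dx μ y := by
  unfold bracket315 bracket316 coeff39
  refine Finset.sum_congr rfl fun y' _ => ?_
  have hsum : ∑ ν : Fin P.d, dKernel ξ⁻¹ ν G0 y y' =
      (∑ ν : Fin P.d, dKernel ξ⁻¹ ν C y y') + ∑ ν : Fin P.d, dKernel ξ⁻¹ ν M y y' := by
    rw [← Finset.sum_add_distrib]
    exact Finset.sum_congr rfl fun ν _ => by rw [hG0, dKernel_add]
  rw [hsum, hC]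
  by_cases h : y' = y
  · subst h
    rw [hdx]
    ring
  · rw [if_neg h]
    ring

/-- kernel: hence (3.15) on the ξ-lattice equals −Σ_μΣ_yξ^dφ(y)·[bracket of (3.16)]q²(∂^ξ_μφ′)(y) under the same hypotheses.
[cite: Balaban1983Higgs3, (3.16) p.437] -/
theorem expr315_eq_bracket316 (ξ : ℝ) (q : W →ₗ[ℝ] W) (G0 C M G : Kernel P j) (g g' : SiteField P j ℝ)
    (dx : Fin P.d → Site P j → Site P j → ℝ) (φ : SiteField P j W) (D : Fin P.d → SiteField P j W)
    (hG0 : G0 = fun y y' => C y y' + M y y')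
    (hC : ∀ y y' : Site P j, ∑ ν : Fin P.d, dKernel ξ⁻¹ ν C y y' = (if y' = y then (ξ ^ P.d)⁻¹ else 0) - C y y')
    (hdx : ∀ (μ : Fin P.d) (y : Site P j), dx μ y y = 0) :
    expr315 ξ q G0 G g g' dx φ D =
      -∑ μ : Fin P.d, ∑ y : Site P j, ξ ^ P.d * (bracket316 ξ C M G g g' dx μ y * ⟪φ y, q (q (D μ y))⟫) := by
  unfold expr315
  congr 1
  refine Finset.sum_congr rfl fun μ _ => Finset.sum_congr rfl fun y _ => ?_
  rw [eq316_bracket ξ G0 C M G g g' dx μ hG0 hC (hdx μ) y]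

end Eq315

end

end Literature.MathematicalPhysics.QuantumFieldTheory.Balaban1983to89.B3Sect3ScalarSelfEnergy
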